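import Mathlib.MeasureTheory.Measure.Haar.Unique
import Mathlib.Topology.Metrizable.Uniformity
import Literature.NumberTheory.Automorphic.TateLocalFactorsProofs
import Literature.NumberTheory.Automorphic.AddCharConductorExponent
import Literature.NumberTheory.Automorphic.PAdicRepsSupercuspidalProofs
import Literature.NumberTheory.GaloisRepresentations.LocalFieldModulus
import HarnessLib

/-!
# Tate's local theory: shells, balls and Haar measures on `F` and `Fˣ` (proved)

Measure-theoretic groundwork for the existence half of Tate's local functional equation
(`TateLocalFunctionalEquation`; Tate 1950, §2.2–2.5), over a non-archimedean local field `F` with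
`q = q_F`, `|·| = |·|_F` (`normAbs`), balls `𝔭^n = primePowBall F n = {x | |x| ≤ q^{-n}}` and unit
filtration `U^n = unitFiltration F n`.  Everything is PROVED (theorems only; no definition, no
named fact, no instance):

* shells `A_k = {x ∈ Fˣ | |x| = q^{-k}} = ϖ^k 𝒪ˣ` (`k ∈ ℤ`): compact open, of the same Haar
  measure as `𝒪ˣ`, pairwise disjoint, and `{x ∈ Fˣ | x ∈ 𝔭^n} = ⋃_{j ≥ 0} A_{n+j}`
  (Tate 1950, §2.5, "`𝔡⁻¹ = ⋃ A_ν`, a disjoint union");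
* `x ↦ 1_{𝔭^n}(x) |x|^t` is integrable on `Fˣ` for `t > 0` (the geometric series
  `∑ q^{-(n+j)t}`; Tate 1950, §2.4, convergence of `ζ(f, c)` for exponent `> 0`), and the
  comparison lemma `integrable_units_of_norm_le` built on it;
* the averaging trick `∫_S G = 0` when `G(ux) = c G(x)`, `c ≠ 1`, `uS = S` (Tate 1950, §2.5:
  "the integral over a subgroup of a character not trivial on it is `0`");
* **Tate's Lemma 2.2.5**, `μ(aM) = |a| μ(M)` for an additive Haar measure `μ`: Weil's module
  (`GaloisRepresentations.modulus`, `LocalFieldModulus`) of `F` IS the normalised absolute value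
  (`modulus_eq_normAbs`: `𝒪 = ⋃_{κ ∈ 𝓀} (κ + ϖ𝒪)` gives `μ(𝒪) = q μ(ϖ𝒪)`), with the
  substitution rule `∫ φ(a x) dμ(x) = |a|⁻¹ ∫ φ dμ`;
* balls: `𝔭^n` is a compact open additive subgroup, and for `ψ` of conductor exponent `m`,
  `∫_{𝔭^n} ψ(xy) dμ(x) = μ(𝔭^n) 1_{𝔭^{m-n}}(y)` (Tate 1950, §2.5, the computation of `f̂_n`:
  "the integral over the compact subgroup of a character trivial / non-trivial on it");
* the unit filtration is a basis of neighbourhoods of `1` in `Fˣ`; hence every quasi-character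
  has a conductor exponent (`QuasiChar.exists_hasConductorExp`; Tate 1950, §2.3), and `Fˣ` is
  pseudo-metrisable and `σ`-compact (so its Haar measures are regular, hence inversion
  invariant — used for Tate's Lemma 2.4.2).

## References

* J. Tate, *Fourier analysis in number fields and Hecke's zeta-functions* (1950), in
  Cassels–Fröhlich, *Algebraic Number Theory* (1967), Ch. XV, §2.2 (Lemma 2.2.5), §2.3, §2.4,
  §2.5. [Tate1950] [CasselsFrohlichANT1967]
* A. Weil, *Basic Number Theory* (1967), Ch. I §2. [WeilBNT1967]
* C. J. Bushnell, G. Henniart, *The local Langlands conjecture for GL(2)* (2006), §1.1, §1.8,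
  §23.1. [BushnellHenniart2006]
-/

set_option autoImplicit false

noncomputable section

open scoped NNReal ENNReal Topology Pointwise
open MeasureTheory ValuativeRel Filter Set Function
  Literature.NumberTheory.GaloisRepresentations.IsNonarchimedeanLocalField

namespace Literature.NumberTheory.Automorphic

variable {F : Type*} [Field F] [ValuativeRel F] [TopologicalSpace F] [IsNonarchimedeanLocalField F]

/-! ### `|·|_F` on units; shells -/

section Shells

/-- `|x|_F = 1 ↔ v(x) = 1`. [folklore] -/
theorem normAbs_eq_one_iff_valuation_eq_one {x : F} : normAbs F x = 1 ↔ valuation F x = 1 := by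
  constructor
  · intro h
    refine le_antisymm ?_ ?_
    · have := normAbs_le_normAbs_iff.1 (show normAbs F x ≤ normAbs F 1 by rw [map_one, h])
      rwa [map_one] at this
    · have := normAbs_le_normAbs_iff.1 (show normAbs F 1 ≤ normAbs F x by rw [map_one, h])
      rwa [map_one] at this
  · exact DeltaCharBorel.normAbs_eq_one_of_valuation_eq_one

/-- `0 < |x|_F` for a unit `x`. [folklore] -/
theorem normAbs_units_pos (x : Fˣ) : 0 < normAbs F (x : F) :=
  pos_iff_ne_zero.2 (normAbs_units_ne_zero x)

/-- `q⁻¹ ^ k ≤ q⁻¹ ^ n ↔ n ≤ k`. [folklore] -/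
theorem inv_residueFieldCard_zpow_le_iff {k n : ℤ} :
    (residueFieldCard F : ℝ≥0)⁻¹ ^ k ≤ (residueFieldCard F : ℝ≥0)⁻¹ ^ n ↔ n ≤ k :=
  zpow_le_zpow_iff_right_of_lt_one₀ inv_residueFieldCard_pos inv_residueFieldCard_lt_one

/-- `k ↦ q⁻¹ ^ k` is injective. [folklore] -/
theorem inv_residueFieldCard_zpow_injective :
    Function.Injective fun k : ℤ => (residueFieldCard F : ℝ≥0)⁻¹ ^ k :=
  (zpow_right_strictAnti₀ inv_residueFieldCard_pos inv_residueFieldCard_lt_one).injective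

/-- A unit of norm `q^{-k}` made from a uniformiser `ϖ` (`|ϖ|_F = q⁻¹`): `|ϖ^k| = q^{-k}`.
[folklore] -/
theorem normAbs_zpow_of_normAbs_eq {ϖ : F} (hϖ : normAbs F ϖ = (residueFieldCard F : ℝ≥0)⁻¹)
    (k : ℤ) : normAbs F (ϖ ^ k) = (residueFieldCard F : ℝ≥0)⁻¹ ^ k := by
  rw [map_zpow₀, hϖ]

/-- **The shell `A_k = {|x| = q^{-k}}` is the translate `ϖ^k · 𝒪ˣ` of the unit group**
(Tate 1950, §2.5: `A_ν = u π^ν`). [cite: Tate1950, §2.5] -/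
theorem shell_eq_smul_unitSphere {ϖ : F} (hϖ : normAbs F ϖ = (residueFieldCard F : ℝ≥0)⁻¹)
    (hϖ0 : ϖ ≠ 0) (k : ℤ) :
    {x : Fˣ | normAbs F (x : F) = (residueFieldCard F : ℝ≥0)⁻¹ ^ k} =
      (Units.mk0 ϖ hϖ0 ^ k) • {x : Fˣ | valuation F (x : F) = 1} := by
  ext x
  rw [Set.mem_smul_set_iff_inv_smul_mem, Set.mem_setOf_eq, Set.mem_setOf_eq,
    ← normAbs_eq_one_iff_valuation_eq_one, smul_eq_mul, Units.val_mul, map_mul,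
    ← zpow_neg, Units.val_zpow_eq_zpow_val, Units.val_mk0, normAbs_zpow_of_normAbs_eq hϖ,
    zpow_neg]
  have h0 : (residueFieldCard F : ℝ≥0)⁻¹ ^ k ≠ 0 := zpow_ne_zero k inv_residueFieldCard_pos.ne'
  rw [inv_mul_eq_one₀ h0, eq_comm]

/-- There is a uniformiser in the normalised-absolute-value sense: `|ϖ|_F = q⁻¹`. [folklore] -/
theorem exists_normAbs_eq_inv : ∃ ϖ : F, ϖ ≠ 0 ∧ normAbs F ϖ = (residueFieldCard F : ℝ≥0)⁻¹ := by
  obtain ⟨a, ha0, ha⟩ := exists_normAbs_eq_inv_zpow_of_int (F := F) 1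
  exact ⟨a, ha0, by rw [ha, zpow_one]⟩

/-- The shells are compact. [folklore] -/
theorem isCompact_shell (k : ℤ) :
    IsCompact {x : Fˣ | normAbs F (x : F) = (residueFieldCard F : ℝ≥0)⁻¹ ^ k} := by
  obtain ⟨ϖ, hϖ0, hϖ⟩ := exists_normAbs_eq_inv (F := F)
  rw [shell_eq_smul_unitSphere hϖ hϖ0 k]
  exact isCompact_units_valuation_eq_one.smul _

/-- The shells are open. [folklore] -/
theorem isOpen_shell (k : ℤ) :
    IsOpen {x : Fˣ | normAbs F (x : F) = (residueFieldCard F : ℝ≥0)⁻¹ ^ k} :=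
  (isLocallyConstant_normAbs_units (F := F)).isOpen_fiber _

/-- The shells are closed. [folklore] -/
theorem isClosed_shell (k : ℤ) :
    IsClosed {x : Fˣ | normAbs F (x : F) = (residueFieldCard F : ℝ≥0)⁻¹ ^ k} :=
  (isLocallyConstant_normAbs_units (F := F)).isClosed_fiber _

/-- The shells are pairwise disjoint. [folklore] -/
theorem pairwise_disjoint_shell :
    Pairwise (Disjoint on fun k : ℤ =>
      {x : Fˣ | normAbs F (x : F) = (residueFieldCard F : ℝ≥0)⁻¹ ^ k}) := by
  intro k l hkl
  rw [Function.onFun, Set.disjoint_left]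
  intro x hxk hxl
  exact hkl (inv_residueFieldCard_zpow_injective (hxk.symm.trans hxl))

/-- **`𝔭^n ∖ {0} = ⋃_{j ≥ 0} A_{n+j}`** (Tate 1950, §2.5: "`𝔡⁻¹ = ⋃_{ν ≥ -d} A_ν`, a disjoint
union"), as subsets of `Fˣ`. [cite: Tate1950, §2.5] -/
theorem setOf_units_mem_primePowBall_eq_iUnion (n : ℤ) :
    {x : Fˣ | (x : F) ∈ primePowBall F n} =
      ⋃ j : ℕ, {x : Fˣ | normAbs F (x : F) = (residueFieldCard F : ℝ≥0)⁻¹ ^ (n + j)} := by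
  ext x
  simp only [Set.mem_setOf_eq, Set.mem_iUnion, mem_primePowBall_iff]
  obtain ⟨k, hk⟩ := exists_normAbs_eq_inv_zpow x.ne_zero
  rw [hk, inv_residueFieldCard_zpow_le_iff]
  constructor
  · intro h
    refine ⟨(k - n).toNat, ?_⟩
    rw [Int.toNat_of_nonneg (sub_nonneg.2 h), add_sub_cancel]
  · rintro ⟨j, hj⟩
    have := inv_residueFieldCard_zpow_injective hj
    omega

variable [MeasurableSpace F] [BorelSpace F]

/-- The shells are measurable. [folklore] -/
theorem measurableSet_normAbs_shell (k : ℤ) :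
    MeasurableSet {x : Fˣ | normAbs F (x : F) = (residueFieldCard F : ℝ≥0)⁻¹ ^ k} := by
  haveI : BorelSpace Fˣ := Units.borelSpace
  exact (isOpen_shell k).measurableSet

/-- `{x ∈ Fˣ | x ∈ 𝔭^n}` is measurable. [folklore] -/
theorem measurableSet_units_mem_primePowBall (n : ℤ) :
    MeasurableSet {x : Fˣ | (x : F) ∈ primePowBall F n} := by
  rw [setOf_units_mem_primePowBall_eq_iUnion]
  exact MeasurableSet.iUnion fun j => measurableSet_normAbs_shell _

omit [BorelSpace F] in
/-- **All shells have the same Haar measure** `μ'(A_k) = μ'(𝒪ˣ)` (`A_k = ϖ^k 𝒪ˣ`;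
Tate 1950, §2.5: `∫_{A_ν} dα = ∫_u dα`). [cite: Tate1950, §2.5] -/
theorem measure_shell (μ' : Measure Fˣ) [μ'.IsMulLeftInvariant] (k : ℤ) :
    μ' {x : Fˣ | normAbs F (x : F) = (residueFieldCard F : ℝ≥0)⁻¹ ^ k} =
      μ' {x : Fˣ | valuation F (x : F) = 1} := by
  obtain ⟨ϖ, hϖ0, hϖ⟩ := exists_normAbs_eq_inv (F := F)
  rw [shell_eq_smul_unitSphere hϖ hϖ0 k, measure_smul]

omit [BorelSpace F] in
/-- `0 < μ'(𝒪ˣ)` for a Haar measure `μ'` on `Fˣ`. [folklore] -/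
theorem measure_unitSphere_pos (μ' : Measure Fˣ) [μ'.IsHaarMeasure] :
    0 < μ' {x : Fˣ | valuation F (x : F) = 1} :=
  isOpen_units_valuation_eq_one.measure_pos μ' ⟨1, by simp⟩

omit [BorelSpace F] in
/-- `μ'(𝒪ˣ) < ∞` for a measure finite on compacts. [folklore] -/
theorem measure_unitSphere_lt_top (μ' : Measure Fˣ) [IsFiniteMeasureOnCompacts μ'] :
    μ' {x : Fˣ | valuation F (x : F) = 1} < ∞ :=
  isCompact_units_valuation_eq_one.measure_lt_top

end Shells


/-! ### Integrability of `1_{𝔭^n} |x|^t` on `Fˣ`; the averaging trick -/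

section Integrability

variable [MeasurableSpace F] [BorelSpace F]

/-- `x ↦ |x|_F` is measurable on `Fˣ` (it is locally constant). [folklore] -/
theorem measurable_normAbs_units : Measurable fun x : Fˣ => ((normAbs F (x : F) : ℝ≥0) : ℝ) := by
  haveI : BorelSpace Fˣ := Units.borelSpace
  exact (NNReal.continuous_coe.comp
    (isLocallyConstant_normAbs_units (F := F)).continuous).measurable

/-- **Convergence of `∫_{𝔭^n ∖ 0} |x|^t d^×x` for `t > 0`** (Tate 1950, §2.4: `ζ(f, c)` converges
for exponent `> 0`; §2.5: `∑_ν q^{-νs}` is geometric): for a left-invariant measure `μ'` on `Fˣ`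
finite on compacts, `∫⁻_{x ∈ 𝔭^n} |x|^t dμ' ≤ μ'(𝒪ˣ) q^{-nt} ∑_j q^{-jt} < ∞`.
[cite: Tate1950, §2.4–2.5] -/
theorem lintegral_primePowBall_rpow_lt_top (μ' : Measure Fˣ) [IsFiniteMeasureOnCompacts μ']
    [μ'.IsMulLeftInvariant] (n : ℤ) {t : ℝ} (ht : 0 < t) :
    ∫⁻ x in {x : Fˣ | (x : F) ∈ primePowBall F n},
      ENNReal.ofReal (((normAbs F (x : F) : ℝ≥0) : ℝ) ^ t) ∂μ' < ∞ := by
  set r : ℝ≥0 := (residueFieldCard F : ℝ≥0)⁻¹ with hr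
  have hr0 : 0 < r := inv_residueFieldCard_pos
  have hr1 : r < 1 := inv_residueFieldCard_lt_one
  have hr0' : (0 : ℝ) < r := by exact_mod_cast hr0
  have hr0le : (0 : ℝ) ≤ r := hr0'.le
  set S : ℕ → Set Fˣ := fun j => {x : Fˣ | normAbs F (x : F) = r ^ (n + (j : ℤ))} with hS
  have hU : {x : Fˣ | (x : F) ∈ primePowBall F n} = ⋃ j, S j :=
    setOf_units_mem_primePowBall_eq_iUnion n
  set ρ : ℝ := (r : ℝ) ^ t with hρ
  have hρ0 : 0 < ρ := Real.rpow_pos_of_pos hr0' t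
  have hρ1 : ρ < 1 := Real.rpow_lt_one hr0le (by exact_mod_cast hr1) ht
  have hval : ∀ j : ℕ, ∀ x ∈ S j,
      ENNReal.ofReal (((normAbs F (x : F) : ℝ≥0) : ℝ) ^ t) =
        ENNReal.ofReal ((((r : ℝ≥0) : ℝ) ^ n) ^ t) * ENNReal.ofReal ρ ^ j := by
    intro j x hx
    rw [Set.mem_setOf_eq] at hx
    rw [hx, NNReal.coe_zpow, zpow_add₀ hr0'.ne', zpow_natCast,
      Real.mul_rpow (zpow_nonneg hr0le _) (pow_nonneg hr0le _),
      ENNReal.ofReal_mul (Real.rpow_nonneg (zpow_nonneg hr0le _) _), ← Real.rpow_natCast,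
      ← Real.rpow_mul hr0le, mul_comm (j : ℝ) t, Real.rpow_mul hr0le, Real.rpow_natCast,
      ENNReal.ofReal_pow hρ0.le]
  calc ∫⁻ x in {x : Fˣ | (x : F) ∈ primePowBall F n},
        ENNReal.ofReal (((normAbs F (x : F) : ℝ≥0) : ℝ) ^ t) ∂μ'
      = ∫⁻ x in ⋃ j, S j, ENNReal.ofReal (((normAbs F (x : F) : ℝ≥0) : ℝ) ^ t) ∂μ' := by rw [hU]
    _ ≤ ∑' j, ∫⁻ x in S j, ENNReal.ofReal (((normAbs F (x : F) : ℝ≥0) : ℝ) ^ t) ∂μ' :=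
        lintegral_iUnion_le _ _
    _ = ∑' j, ENNReal.ofReal ((((r : ℝ≥0) : ℝ) ^ n) ^ t) * ENNReal.ofReal ρ ^ j * μ' (S j) := by
        congr 1
        ext j
        rw [setLIntegral_congr_fun (measurableSet_normAbs_shell _) (fun x hx => hval j x hx),
          setLIntegral_const]
    _ = ∑' j : ℕ, ENNReal.ofReal ((((r : ℝ≥0) : ℝ) ^ n) ^ t) *
          μ' {x : Fˣ | valuation F (x : F) = 1} * ENNReal.ofReal ρ ^ j := by
        congr 1
        ext j
        rw [measure_shell μ']
        ring
    _ = ENNReal.ofReal ((((r : ℝ≥0) : ℝ) ^ n) ^ t) * μ' {x : Fˣ | valuation F (x : F) = 1} *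
          ∑' j : ℕ, ENNReal.ofReal ρ ^ j := by
        rw [ENNReal.tsum_mul_left]
    _ < ∞ := by
        rw [ENNReal.tsum_geometric]
        refine ENNReal.mul_lt_top
          (ENNReal.mul_lt_top ENNReal.ofReal_lt_top (measure_unitSphere_lt_top μ')) ?_
        rw [ENNReal.inv_lt_top, tsub_pos_iff_lt]
        exact ENNReal.ofReal_lt_one.2 hρ1

/-- **Comparison lemma**: a strongly measurable `G : Fˣ → ℂ` dominated by
`C · 1_{𝔭^n}(x) |x|^t` with `t > 0` is integrable for every left-invariant measure finite on
compacts (Tate 1950, §2.4, absolute convergence of zeta integrals). [cite: Tate1950, §2.4] -/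
theorem integrable_units_of_norm_le (μ' : Measure Fˣ) [IsFiniteMeasureOnCompacts μ']
    [μ'.IsMulLeftInvariant] {G : Fˣ → ℂ} (hG : AEStronglyMeasurable G μ') (n : ℤ) {t : ℝ}
    (ht : 0 < t) (C : ℝ)
    (hle : ∀ x : Fˣ, ‖G x‖ ≤ C * {x : Fˣ | (x : F) ∈ primePowBall F n}.indicator
      (fun x => ((normAbs F (x : F) : ℝ≥0) : ℝ) ^ t) x) :
    Integrable G μ' := by
  set B : Set Fˣ := {x : Fˣ | (x : F) ∈ primePowBall F n} with hB
  set g : Fˣ → ℝ := fun x => B.indicator (fun x => ((normAbs F (x : F) : ℝ≥0) : ℝ) ^ t) x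
    with hg
  have hBm : MeasurableSet B := measurableSet_units_mem_primePowBall n
  have hgm : Measurable g :=
    (measurable_normAbs_units.pow_const t).indicator hBm
  have hg_nonneg : ∀ x, 0 ≤ g x := fun x =>
    Set.indicator_nonneg (fun y _ => Real.rpow_nonneg (NNReal.coe_nonneg _) _) x
  have hgi : Integrable g μ' := by
    refine ⟨hgm.aestronglyMeasurable, ?_⟩
    have h1 : ∫⁻ x, ‖g x‖ₑ ∂μ' = ∫⁻ x in B, ENNReal.ofReal (((normAbs F (x : F) : ℝ≥0) : ℝ) ^ t) ∂μ' := by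
      rw [← lintegral_indicator hBm]
      congr 1
      ext x
      rw [Real.enorm_eq_ofReal (hg_nonneg x)]
      by_cases hx : x ∈ B
      · simp only [hg, Set.indicator_of_mem hx]
      · simp only [hg, Set.indicator_of_notMem hx, ENNReal.ofReal_zero]
    rw [HasFiniteIntegral, h1]
    exact lintegral_primePowBall_rpow_lt_top μ' n ht
  exact Integrable.mono' (hgi.const_mul C) hG (Filter.Eventually.of_forall hle)

/-- **The averaging trick** (Tate 1950, §2.5: the integral of a character over a compact group
on which it is non-trivial vanishes — "`∫_{1+𝔭^{-d-ν}} c_n(α) dα = 0`"): if `S ⊆ Fˣ` is stable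
under `x ↦ ux` and `G(ux) = c · G(x)` on `S` with `c ≠ 1`, then `∫_S G dμ' = 0` for every
left-invariant `μ'`. [cite: Tate1950, §2.5] -/
theorem setIntegral_eq_zero_of_mul_left (μ' : Measure Fˣ) [μ'.IsMulLeftInvariant]
    {S : Set Fˣ} (hS : MeasurableSet S) {u : Fˣ} (huS : ∀ x, u * x ∈ S ↔ x ∈ S)
    {G : Fˣ → ℂ} {c : ℂ} (hc : c ≠ 1) (hG : ∀ x ∈ S, G (u * x) = c * G x) :
    ∫ x in S, G x ∂μ' = 0 := by
  haveI : BorelSpace Fˣ := Units.borelSpace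
  have h3 : ∀ x, S.indicator G (u * x) = c * S.indicator G x := by
    intro x
    by_cases hx : x ∈ S
    · rw [Set.indicator_of_mem ((huS x).2 hx), Set.indicator_of_mem hx, hG x hx]
    · rw [Set.indicator_of_notMem (mt (huS x).1 hx), Set.indicator_of_notMem hx, mul_zero]
  have h2 : ∫ x, S.indicator G (u * x) ∂μ' = ∫ x, S.indicator G x ∂μ' :=
    integral_mul_left_eq_self _ u
  have h4 : ∫ x, S.indicator G x ∂μ' = c * ∫ x, S.indicator G x ∂μ' := by
    rw [← integral_const_mul, ← h2]
    exact integral_congr_ae (Filter.Eventually.of_forall h3)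
  have h5 : (1 - c) * ∫ x, S.indicator G x ∂μ' = 0 := by
    rw [sub_mul, one_mul, ← h4, sub_self]
  rw [← integral_indicator hS]
  exact (mul_eq_zero.1 h5).resolve_left (sub_ne_zero.2 (Ne.symm hc))

end Integrability


/-! ### Balls `𝔭^n ⊆ F`: a compact open neighbourhood basis of `0`; `F` is pseudo-metrisable (and `σ`-compact, `sigmaCompactSpace_of_isNonarchimedeanLocalField`) -/

section Balls

/-- `𝔭^n` is a valuation ball `{v ≤ v(a)}` (`|a| = q^{-n}`). [folklore] -/
theorem exists_primePowBall_eq_setOf_valuation_le (n : ℤ) :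
    ∃ a : F, a ≠ 0 ∧ primePowBall F n = {x : F | valuation F x ≤ valuation F a} := by
  obtain ⟨a, ha0, ha⟩ := exists_normAbs_eq_inv_zpow_of_int (F := F) n
  refine ⟨a, ha0, Set.ext fun x => ?_⟩
  rw [mem_primePowBall_iff, Set.mem_setOf_eq, ← ha, normAbs_le_normAbs_iff]

/-- **`𝔭^n` is compact** (Bushnell–Henniart 2006, §1.1). [cite: BushnellHenniart2006, §1.1] -/
theorem isCompact_primePowBall (n : ℤ) : IsCompact (primePowBall F n) := by
  obtain ⟨a, -, h⟩ := exists_primePowBall_eq_setOf_valuation_le (F := F) n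
  rw [h]
  exact IsNonarchimedeanLocalField.isCompact_closedBall F _

/-- **`𝔭^n` is open** (Bushnell–Henniart 2006, §1.1). [cite: BushnellHenniart2006, §1.1] -/
theorem isOpen_primePowBall (n : ℤ) : IsOpen (primePowBall F n) := by
  obtain ⟨a, ha0, h⟩ := exists_primePowBall_eq_setOf_valuation_le (F := F) n
  rw [h]
  exact DeltaCharBorel.isOpen_setOf_valuation_le ((map_ne_zero _).2 ha0)

/-- `𝔭^n` is closed. [folklore] -/
theorem isClosed_primePowBall (n : ℤ) : IsClosed (primePowBall F n) := by
  haveI : T2Space F := (GaloisRepresentations.IsNonarchimedeanLocalField.isLocalField F).toT2Space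
  exact (isCompact_primePowBall n).isClosed

/-- **The balls `𝔭^n` form a basis of neighbourhoods of `0`.** [folklore] -/
theorem exists_primePowBall_subset_of_mem_nhds_zero {W : Set F} (hW : W ∈ 𝓝 (0 : F)) :
    ∃ n : ℕ, primePowBall F (n : ℤ) ⊆ W := by
  obtain ⟨γ, hγ⟩ := (IsValuativeTopology.mem_nhds_zero_iff W).1 hW
  obtain ⟨g, hg⟩ := ValuativeRel.valuation_surjective (γ : ValueGroupWithZero F)
  have hg0 : g ≠ 0 := by
    rintro rfl
    exact γ.ne_zero (by simpa using hg.symm)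
  obtain ⟨k, hk⟩ := exists_normAbs_eq_inv_zpow hg0
  refine ⟨(k + 1).toNat, fun x hx => hγ ?_⟩
  rw [Set.mem_setOf_eq, ← hg, ← normAbs_lt_normAbs_iff, hk]
  refine lt_of_le_of_lt (hx.trans ?_) (zpow_lt_zpow_right_of_lt_one₀ inv_residueFieldCard_pos
    inv_residueFieldCard_lt_one (lt_add_one k))
  exact inv_residueFieldCard_zpow_le_iff.2 (Int.self_le_toNat _)

/-- The balls `𝔭^n`, `n ∈ ℕ`, as a filter basis of `𝓝 0`. [folklore] -/
theorem hasBasis_nhds_zero_primePowBall :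
    (𝓝 (0 : F)).HasBasis (fun _ : ℕ => True) fun n => primePowBall F (n : ℤ) := by
  refine ⟨fun W => ⟨fun hW => ?_, fun ⟨n, _, hn⟩ =>
    Filter.mem_of_superset (primePowBall_mem_nhds_zero _) hn⟩⟩
  obtain ⟨n, hn⟩ := exists_primePowBall_subset_of_mem_nhds_zero hW
  exact ⟨n, trivial, hn⟩

variable (F) in
/-- **`F` is pseudo-metrisable**: `𝓝 0` has the countable basis `(𝔭^n)_n`, so the uniformity
of the topological additive group `F` is countably generated. A theorem (invoke with `haveI`).
[folklore] -/
theorem pseudoMetrizableSpace_localField : TopologicalSpace.PseudoMetrizableSpace F := by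
  haveI : (𝓝 (0 : F)).IsCountablyGenerated := hasBasis_nhds_zero_primePowBall.isCountablyGenerated
  refine ⟨⟨IsTopologicalAddGroup.rightUniformSpace F, rfl, ?_⟩⟩
  change (Filter.comap (fun p : F × F => p.2 + -p.1) (𝓝 0)).IsCountablyGenerated
  infer_instance

variable (F) in
/-- **`F` is second countable** (`σ`-compact, hence Lindelöf, and pseudo-metrisable). A theorem
(invoke with `haveI`); it makes Borel structures on products `F × X`, `Fˣ × F` behave. [folklore] -/
theorem secondCountableTopology_localField : SecondCountableTopology F := by
  haveI := pseudoMetrizableSpace_localField F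
  haveI := sigmaCompactSpace_of_isNonarchimedeanLocalField F
  infer_instance

variable [MeasurableSpace F] [BorelSpace F]

/-- `𝔭^n` is measurable. [folklore] -/
theorem measurableSet_primePowBall (n : ℤ) : MeasurableSet (primePowBall F n) :=
  (isOpen_primePowBall n).measurableSet

omit [BorelSpace F] in
/-- `0 < μ(𝔭^n)` for an additive Haar measure. [folklore] -/
theorem addHaar_primePowBall_pos (μ : Measure F) [μ.IsAddHaarMeasure] (n : ℤ) :
    0 < μ (primePowBall F n) :=
  (isOpen_primePowBall n).measure_pos μ ⟨0, zero_mem_primePowBall n⟩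

omit [BorelSpace F] in
/-- `μ(𝔭^n) < ∞` for a measure finite on compacts. [folklore] -/
theorem measure_primePowBall_lt_top (μ : Measure F) [IsFiniteMeasureOnCompacts μ] (n : ℤ) :
    μ (primePowBall F n) < ∞ :=
  (isCompact_primePowBall n).measure_lt_top

/-- Additive Haar measures on `F` are regular (`F` is `σ`-compact and pseudo-metrisable).
A theorem (invoke with `haveI`). [folklore] -/
theorem regular_of_isAddHaarMeasure (μ : Measure F) [μ.IsAddHaarMeasure] : μ.Regular := by
  haveI := pseudoMetrizableSpace_localField F
  haveI := sigmaCompactSpace_of_isNonarchimedeanLocalField F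
  infer_instance

end Balls

/-! ### Tate's Lemma 2.2.5: the module of `F` is `|·|_F` -/

section Modulus

omit [TopologicalSpace F] [IsNonarchimedeanLocalField F] in
/-- Units of `𝒪` preserve `𝒪 = {v ≤ 1}`. [folklore] -/
theorem smul_closedBall_eq_of_valuation_eq_one {u : F} (hu : valuation F u = 1) :
    u • {x : F | valuation F x ≤ 1} = {x : F | valuation F x ≤ 1} := by
  have hu0 : u ≠ 0 := by
    rintro rfl
    simp at hu
  ext x
  rw [Set.mem_smul_set_iff_inv_smul_mem₀ hu0, Set.mem_setOf_eq, Set.mem_setOf_eq, smul_eq_mul,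
    map_mul, map_inv₀, hu, inv_one, one_mul]

/-- `ϖ 𝒪 = 𝔪 = {v < 1}` for a uniformiser `ϖ`. [folklore] -/
theorem smul_closedBall_eq_of_uniformizer {ϖ : F}
    (hϖ : IsNonarchimedeanLocalField.valueGroupWithZeroIsoInt F (valuation F ϖ) =
      WithZero.exp (-1 : ℤ)) :
    ϖ • {x : F | valuation F x ≤ 1} = {x : F | valuation F x < 1} := by
  have hϖ0 := DeltaCharBorel.uniformizer_ne_zero hϖ
  ext x
  rw [Set.mem_smul_set_iff_inv_smul_mem₀ hϖ0, Set.mem_setOf_eq, Set.mem_setOf_eq, smul_eq_mul,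
    map_mul, map_inv₀, DeltaCharBorel.valuation_lt_one_iff hϖ,
    inv_mul_le_iff₀ (zero_lt_iff.2 (DeltaCharBorel.valuation_uniformizer_ne_zero hϖ)), mul_one]

/-- **`𝒪 = ⋃_{κ ∈ 𝓀} (s(κ) + 𝔪)`** for a section `s` of the residue map (Tate 1950, §2.2,
proof of Lemma 2.2.5: "there are `N(αo)` cosets of `αo` in `o`"). [cite: Tate1950, §2.2, Lemma 2.2.5] -/
theorem closedBall_eq_iUnion_vadd (s : 𝓀[F] → 𝒪[F]) (hs : ∀ κ, IsLocalRing.residue _ (s κ) = κ) :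
    {x : F | valuation F x ≤ 1} = ⋃ κ, ((s κ : 𝒪[F]) : F) +ᵥ {x : F | valuation F x < 1} := by
  ext x
  simp only [Set.mem_iUnion, Set.mem_vadd_set, Set.mem_setOf_eq, vadd_eq_add]
  constructor
  · intro hx
    set x' : 𝒪[F] := ⟨x, (Valuation.mem_integer_iff _ _).2 hx⟩ with hx'
    refine ⟨IsLocalRing.residue _ x', x - s (IsLocalRing.residue _ x'), ?_, by abel⟩
    have h := (DeltaCharBorel.residue_eq_residue_iff _ _).1
      (hs (IsLocalRing.residue _ x')).symm
    exact h
  · rintro ⟨κ, m, hm, rfl⟩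
    exact (Valuation.map_add _ _ _).trans
      (max_le ((Valuation.mem_integer_iff _ _).1 (s κ).2) hm.le)

/-- The translates `s(κ) + 𝔪`, `κ ∈ 𝓀`, are pairwise disjoint. [folklore] -/
theorem pairwise_disjoint_vadd_residue (s : 𝓀[F] → 𝒪[F])
    (hs : ∀ κ, IsLocalRing.residue _ (s κ) = κ) :
    Pairwise (Disjoint on fun κ : 𝓀[F] => ((s κ : 𝒪[F]) : F) +ᵥ {x : F | valuation F x < 1}) := by
  intro i j hij
  rw [Function.onFun, Set.disjoint_left]
  rintro x ⟨m, hm, rfl⟩ ⟨m', hm', h⟩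
  apply hij
  rw [← hs i, ← hs j]
  apply (DeltaCharBorel.residue_eq_residue_iff _ _).2
  simp only [vadd_eq_add, Set.mem_setOf_eq] at h hm hm'
  have hsub : ((s i : 𝒪[F]) : F) - s j = m' - m := by linear_combination -h
  rw [hsub]
  exact lt_of_le_of_lt (Valuation.map_sub _ _ _) (max_lt hm' hm)

variable [MeasurableSpace F] [BorelSpace F]

/-- **`μ(𝒪) = q · μ(𝔪)`** for an additive left-invariant measure (Tate 1950, §2.2, proof of
Lemma 2.2.5). [cite: Tate1950, §2.2, Lemma 2.2.5] -/
theorem measure_closedBall_eq_card_mul (μ : Measure F) [μ.IsAddLeftInvariant] :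
    μ {x : F | valuation F x ≤ 1} = residueFieldCard F * μ {x : F | valuation F x < 1} := by
  classical
  obtain ⟨s, hs⟩ : ∃ s : 𝓀[F] → 𝒪[F], ∀ κ, IsLocalRing.residue _ (s κ) = κ :=
    ⟨Function.surjInv IsLocalRing.residue_surjective,
      Function.surjInv_eq IsLocalRing.residue_surjective⟩
  haveI : Fintype 𝓀[F] := Fintype.ofFinite _
  rw [closedBall_eq_iUnion_vadd s hs, measure_iUnion (pairwise_disjoint_vadd_residue s hs)
      (fun κ => ((DeltaCharBorel.isOpen_setOf_valuation_lt _).measurableSet.const_vadd _))]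
  simp only [measure_vadd, tsum_fintype, Finset.sum_const, Finset.card_univ, nsmul_eq_mul,
    residueFieldCard, Nat.card_eq_fintype_card]

omit [MeasurableSpace F] [BorelSpace F] in
/-- **Tate's Lemma 2.2.5: Weil's module of `F` is the normalised absolute value**, `mod_F = |·|_F`
(Tate 1950, §2.2, Lemma 2.2.5: "`μ(αM) = |α| μ(M)` … for `α` integral there are `N(αo)` cosets
of `αo` in `o`"; Weil 1967, Ch. I §2).  Both sides are multiplicative, `1` on `𝒪ˣ` (units
preserve `𝒪`) and `q⁻¹` at a uniformiser (`μ(𝒪) = q μ(ϖ𝒪)`). [cite: Tate1950, §2.2, Lemma 2.2.5] -/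
theorem modulus_eq_normAbs (a : F) : GaloisRepresentations.modulus F a = normAbs F a := by
  by_cases ha : a = 0
  · simp [ha]
  borelize F
  haveI : T2Space F := (GaloisRepresentations.IsNonarchimedeanLocalField.isLocalField F).toT2Space
  set μ : Measure F := Measure.addHaar with hμ
  haveI : μ.Regular := regular_of_isAddHaarMeasure μ
  set O : Set F := {x : F | valuation F x ≤ 1} with hO
  set M : Set F := {x : F | valuation F x < 1} with hM
  have hOc : IsCompact O := IsNonarchimedeanLocalField.isCompact_closedBall F 1
  have hOo : IsOpen O := DeltaCharBorel.isOpen_setOf_valuation_le one_ne_zero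
  have hMo : IsOpen M := DeltaCharBorel.isOpen_setOf_valuation_lt 1
  have hO0 : μ O ≠ 0 := (hOo.measure_pos μ ⟨0, by simp [hO]⟩).ne'
  have hOtop : μ O ≠ ∞ := hOc.measure_lt_top.ne
  have hM0 : μ M ≠ 0 := (hMo.measure_pos μ ⟨0, by simp [hM]⟩).ne'
  have hMO : M ⊆ O := fun x hx => le_of_lt (by simpa [hM] using hx)
  have hMtop : μ M ≠ ∞ := ((measure_mono hMO).trans_lt hOc.measure_lt_top).ne
  -- units
  have hunit : ∀ u : F, valuation F u = 1 → GaloisRepresentations.modulus F u = 1 := by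
    intro u hu
    have hu0 : u ≠ 0 := by
      rintro rfl
      simp at hu
    have h := GaloisRepresentations.measure_smul_set_of_ne_zero μ hu0 O
    rw [smul_closedBall_eq_of_valuation_eq_one hu] at h
    have : (GaloisRepresentations.modulus F u : ℝ≥0∞) = 1 := by
      rw [← ENNReal.mul_left_inj hO0 hOtop, one_mul]
      exact h.symm
    exact_mod_cast this
  -- a uniformiser
  obtain ⟨ϖ, hϖ⟩ := DeltaCharBorel.exists_uniformizer F
  have hϖ0 := DeltaCharBorel.uniformizer_ne_zero hϖ
  have hunif : GaloisRepresentations.modulus F ϖ = (residueFieldCard F : ℝ≥0)⁻¹ := by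
    have h := GaloisRepresentations.measure_smul_set_of_ne_zero μ hϖ0 O
    rw [smul_closedBall_eq_of_uniformizer hϖ, measure_closedBall_eq_card_mul μ, ← mul_assoc] at h
    have h2 : (GaloisRepresentations.modulus F ϖ : ℝ≥0∞) * (residueFieldCard F : ℝ≥0∞) = 1 := by
      rw [← ENNReal.mul_left_inj hM0 hMtop, one_mul]
      exact h.symm
    have h3 : GaloisRepresentations.modulus F ϖ * (residueFieldCard F : ℝ≥0) = 1 := by
      exact_mod_cast h2
    exact eq_inv_of_mul_eq_one_left h3
  -- the general element `a = (a ϖ^m) ϖ^{-m}`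
  set m : ℤ := WithZero.log (IsNonarchimedeanLocalField.valueGroupWithZeroIsoInt F (valuation F a))
    with hm
  have hu : valuation F (a * ϖ ^ m) = 1 := DeltaCharBorel.valuation_mul_uniformizer_zpow_log hϖ ha
  calc GaloisRepresentations.modulus F a
      = GaloisRepresentations.modulus F (a * ϖ ^ m * ϖ ^ (-m)) := by
          rw [mul_assoc, ← zpow_add₀ hϖ0, add_neg_cancel, zpow_zero, mul_one]
    _ = (residueFieldCard F : ℝ≥0) ^ m := by
          rw [map_mul, map_zpow₀, hunit _ hu, hunif, one_mul, inv_zpow', neg_neg]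
    _ = normAbs F a := (DeltaCharBorel.normAbs_eq_zpow_log ha).symm

/-- **`μ(a • s) = |a|_F μ(s)`** for an additive Haar measure `μ` and `a ≠ 0` (Tate 1950,
Lemma 2.2.5). [cite: Tate1950, §2.2, Lemma 2.2.5] -/
theorem addHaar_smul_set (μ : Measure F) [μ.IsAddHaarMeasure] {a : F} (ha : a ≠ 0) (s : Set F) :
    μ (a • s) = normAbs F a * μ s := by
  haveI : μ.Regular := regular_of_isAddHaarMeasure μ
  rw [GaloisRepresentations.measure_smul_set_of_ne_zero μ ha s, modulus_eq_normAbs]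

/-- The image of `μ` under `x ↦ a x` is `|a|⁻¹ μ` (Tate 1950, §2.2: "`dμ(αξ) = |α| dμ(ξ)`").
[cite: Tate1950, §2.2, Lemma 2.2.5] -/
theorem map_mul_left_addHaar (μ : Measure F) [μ.IsAddHaarMeasure] {a : F} (ha : a ≠ 0) :
    Measure.map (fun x => a * x) μ = ((normAbs F a⁻¹ : ℝ≥0) : ℝ≥0∞) • μ := by
  ext s hs
  rw [Measure.map_apply (measurable_const_mul a) hs, Measure.smul_apply, smul_eq_mul,
    ← addHaar_smul_set μ (inv_ne_zero ha) s]
  change μ ((fun x => a • x) ⁻¹' s) = _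
  rw [Set.preimage_smul₀ ha]

/-- **Substitution rule** `∫ φ(a x) dμ(x) = |a|⁻¹ ∫ φ dμ` (Tate 1950, §2.2:
"`∫ f(ξ) dμ(ξ) = |α| ∫ f(αξ) dμ(ξ)`"). [cite: Tate1950, §2.2, Lemma 2.2.5] -/
theorem integral_comp_mul_left {E : Type*} [NormedAddCommGroup E] [NormedSpace ℝ E]
    (μ : Measure F) [μ.IsAddHaarMeasure] {a : F} (ha : a ≠ 0) (φ : F → E) :
    ∫ x, φ (a * x) ∂μ = ((normAbs F a⁻¹ : ℝ≥0) : ℝ) • ∫ x, φ x ∂μ := by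
  have h := integral_map_equiv (μ := μ) (MeasurableEquiv.mulLeft₀ a ha) φ
  rw [show ((MeasurableEquiv.mulLeft₀ a ha : F ≃ᵐ F) : F → F) = fun x => a * x from rfl,
    map_mul_left_addHaar μ ha, integral_smul_measure, ENNReal.coe_toReal] at h
  rw [← h]

/-- Integrability is invariant under the substitution `x ↦ a x`. [folklore] -/
theorem integrable_comp_mul_left_iff {E : Type*} [NormedAddCommGroup E]
    (μ : Measure F) [μ.IsAddHaarMeasure] {a : F} (ha : a ≠ 0) (φ : F → E) :
    Integrable (fun x => φ (a * x)) μ ↔ Integrable φ μ := by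
  have h := integrable_map_equiv (μ := μ) (MeasurableEquiv.mulLeft₀ a ha) φ
  rw [show ((MeasurableEquiv.mulLeft₀ a ha : F ≃ᵐ F) : F → F) = fun x => a * x from rfl,
    map_mul_left_addHaar μ ha,
    integrable_smul_measure (by simpa using normAbs_units_ne_zero (Units.mk0 a ha)⁻¹)
      ENNReal.coe_ne_top] at h
  exact h.symm

end Modulus


/-! ### The Fourier transform of `1_{𝔭^n}`: integrating `ψ(xy)` over a ball -/

section CharacterIntegral

/-- `𝔭^n · 𝔭^k ⊆ 𝔭^{n+k}`. [folklore] -/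
theorem mul_mem_primePowBall {n k : ℤ} {x y : F} (hx : x ∈ primePowBall F n)
    (hy : y ∈ primePowBall F k) : x * y ∈ primePowBall F (n + k) := by
  rw [mem_primePowBall_iff] at hx hy ⊢
  rw [map_mul, zpow_add₀ inv_residueFieldCard_pos.ne']
  exact mul_le_mul' hx hy

/-- If `y ∉ 𝔭^{m-n}` and `ψ` has conductor exponent `m`, some `x₀ ∈ 𝔭^n` has `ψ(x₀ y) ≠ 1`
(`ψ` is non-trivial on `𝔭^{m-1} ⊆ y 𝔭^n`). [folklore] -/
theorem exists_mem_primePowBall_addChar_mul_ne_one {ψ : AddChar F Circle} {m : ℤ}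
    (hm : ψ.HasConductorExp m) {n : ℤ} {y : F} (hy : y ∉ primePowBall F (m - n)) :
    ∃ x₀ ∈ primePowBall F n, ψ (x₀ * y) ≠ 1 := by
  set r : ℝ≥0 := (residueFieldCard F : ℝ≥0)⁻¹ with hr
  have hr0 : 0 < r := inv_residueFieldCard_pos
  obtain ⟨z, hz, hz1⟩ := hm.2
  have hy0 : y ≠ 0 := by
    rintro rfl
    exact hy (zero_mem_primePowBall _)
  obtain ⟨j, hj⟩ := exists_normAbs_eq_inv_zpow hy0
  have hjlt : j < m - n := by
    by_contra hle
    push Not at hle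
    exact hy (by rw [mem_primePowBall_iff, hj]; exact inv_residueFieldCard_zpow_le_iff.2 hle)
  refine ⟨z * y⁻¹, ?_, by rwa [inv_mul_cancel_right₀ hy0]⟩
  rw [mem_primePowBall_iff, map_mul, map_inv₀, hj]
  rw [mem_primePowBall_iff] at hz
  calc normAbs F z * (r ^ j)⁻¹ ≤ r ^ (m - 1) * (r ^ j)⁻¹ := by gcongr
    _ = r ^ (m - 1 - j) := by rw [← zpow_neg, ← zpow_add₀ hr0.ne', ← sub_eq_add_neg]
    _ ≤ r ^ n := inv_residueFieldCard_zpow_le_iff.2 (by omega)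

variable [MeasurableSpace F] [BorelSpace F]

open scoped Classical in
/-- **The Fourier transform of the characteristic function of a ball** (Tate 1950, §2.5, the
computation of `f̂_n`: "the integral, over the compact subgroup, of the additive character … is
the measure of the subgroup if the character is trivial on it, and `0` otherwise"): for `ψ` of
conductor exponent `m` and an additive Haar measure `μ`,
`∫_{𝔭^n} ψ(xy) dμ(x) = μ(𝔭^n)` if `y ∈ 𝔭^{m-n}` and `= 0` otherwise. [cite: Tate1950, §2.5] -/
theorem setIntegral_primePowBall_addChar_mul (μ : Measure F) [μ.IsAddHaarMeasure]
    {ψ : AddChar F Circle} {m : ℤ} (hm : ψ.HasConductorExp m) (n : ℤ) (y : F) :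
    ∫ x in primePowBall F n, ((ψ (x * y) : Circle) : ℂ) ∂μ =
      if y ∈ primePowBall F (m - n) then (μ.real (primePowBall F n) : ℂ) else 0 := by
  split_ifs with hy
  · have h1 : ∀ x ∈ primePowBall F n, ((ψ (x * y) : Circle) : ℂ) = 1 := by
      intro x hx
      have hxy : x * y ∈ primePowBall F m := by
        have := mul_mem_primePowBall hx hy
        rwa [add_sub_cancel] at this
      rw [hm.1 _ hxy, Circle.coe_one]
    rw [setIntegral_congr_fun (measurableSet_primePowBall n) h1, setIntegral_const,
      Complex.real_smul, mul_one, measureReal_def]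
  · obtain ⟨x₀, hx₀, hne⟩ := exists_mem_primePowBall_addChar_mul_ne_one hm hy
    have hne' : ((ψ (x₀ * y) : Circle) : ℂ) ≠ 1 := fun h => hne (Circle.coe_eq_one.1 h)
    have key : ∫ x in primePowBall F n, ((ψ (x * y) : Circle) : ℂ) ∂μ =
        (ψ (x₀ * y) : ℂ) * ∫ x in primePowBall F n, ((ψ (x * y) : Circle) : ℂ) ∂μ := by
      rw [← integral_indicator (measurableSet_primePowBall n), ← integral_const_mul,
        ← integral_add_left_eq_self _ x₀]
      refine integral_congr_ae (Filter.Eventually.of_forall fun x => ?_)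
      by_cases hx : x ∈ primePowBall F n
      · have hx' : x₀ + x ∈ primePowBall F n := add_mem_primePowBall hx₀ hx
        simp only [Set.indicator_of_mem hx', Set.indicator_of_mem hx, add_mul,
          AddChar.map_add_eq_mul, Circle.coe_mul]
      · have hx' : x₀ + x ∉ primePowBall F n := fun h => hx (by
          simpa using add_mem_primePowBall (neg_mem_primePowBall hx₀) h)
        simp only [Set.indicator_of_notMem hx', Set.indicator_of_notMem hx, mul_zero]
    have h5 : (1 - ((ψ (x₀ * y) : Circle) : ℂ)) *
        ∫ x in primePowBall F n, ((ψ (x * y) : Circle) : ℂ) ∂μ = 0 := by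
      rw [sub_mul, one_mul, ← key, sub_self]
    exact (mul_eq_zero.1 h5).resolve_left (sub_ne_zero.2 (Ne.symm hne'))

end CharacterIntegral

/-! ### The unit filtration is a neighbourhood basis of `1` in `Fˣ`; conductor exponents;
`Fˣ` is pseudo-metrisable and `σ`-compact -/

section UnitFiltration

/-- For `n ≥ 1`: `x ∈ U^n ↔ x - 1 ∈ 𝔭^n` (the condition `|x| = 1` is automatic). [folklore] -/
theorem mem_unitFiltration_iff_sub_one_mem {n : ℕ} (hn : 1 ≤ n) (x : Fˣ) :
    x ∈ unitFiltration F n ↔ (x : F) - 1 ∈ primePowBall F (n : ℤ) := by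
  constructor
  · intro hx
    rw [mem_primePowBall_iff, zpow_natCast]
    exact hx.2
  · intro hx
    rw [mem_primePowBall_iff, zpow_natCast] at hx
    refine ⟨?_, hx⟩
    have hlt : normAbs F ((x : F) - 1) < normAbs F 1 := by
      rw [map_one]
      exact lt_of_le_of_lt hx (pow_lt_one₀ inv_residueFieldCard_pos.le
        inv_residueFieldCard_lt_one (by omega))
    rw [normAbs_lt_normAbs_iff] at hlt
    rw [normAbs_eq_one_iff_valuation_eq_one,
      show (x : F) = 1 + ((x : F) - 1) by ring, Valuation.map_add_eq_of_lt_left _ hlt, map_one]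

/-- The unit filtration decreases. [folklore] -/
theorem unitFiltration_antitone {n n' : ℕ} (h : n ≤ n') : unitFiltration F n' ⊆ unitFiltration F n :=
  fun _ hx => ⟨hx.1, hx.2.trans (pow_le_pow_right_of_le_one' inv_residueFieldCard_lt_one.le h)⟩

/-- **Each `U^n` is a neighbourhood of `1` in `Fˣ`.** [folklore] -/
theorem unitFiltration_mem_nhds_one (n : ℕ) : unitFiltration F n ∈ 𝓝 (1 : Fˣ) := by
  have hcont : Continuous fun x : Fˣ => (x : F) - 1 := Units.continuous_val.sub continuous_const
  have h1 : unitFiltration F (n + 1) ∈ 𝓝 (1 : Fˣ) := by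
    have hpre : (fun x : Fˣ => (x : F) - 1) ⁻¹' primePowBall F ((n + 1 : ℕ) : ℤ) ∈ 𝓝 (1 : Fˣ) :=
      hcont.continuousAt.preimage_mem_nhds (by simpa using primePowBall_mem_nhds_zero _)
    refine Filter.mem_of_superset hpre fun x hx => ?_
    exact (mem_unitFiltration_iff_sub_one_mem (by omega) x).2 hx
  exact Filter.mem_of_superset h1 (unitFiltration_antitone (Nat.le_succ n))

/-- **The unit filtration is a basis of neighbourhoods of `1` in `Fˣ`** (Tate 1950, §2.3: "the
subgroups `1 + 𝔭^ν`, `ν > 0`, of `u` form a fundamental system of neighborhoods of `1`").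
[cite: Tate1950, §2.3] -/
theorem exists_unitFiltration_subset {V : Set Fˣ} (hV : V ∈ 𝓝 (1 : Fˣ)) :
    ∃ n : ℕ, 1 ≤ n ∧ unitFiltration F n ⊆ V := by
  rw [Units.isEmbedding_val₀.nhds_eq_comap, Filter.mem_comap] at hV
  obtain ⟨W, hW, hWV⟩ := hV
  rw [Units.val_one] at hW
  have hW' : (fun t : F => 1 + t) ⁻¹' W ∈ 𝓝 (0 : F) :=
    (continuous_const.add continuous_id).continuousAt.preimage_mem_nhds (by simpa using hW)
  obtain ⟨n, hn⟩ := exists_primePowBall_subset_of_mem_nhds_zero hW'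
  refine ⟨n + 1, by omega, fun x hx => hWV ?_⟩
  have hx' := (mem_unitFiltration_iff_sub_one_mem (by omega) x).1 hx
  have := hn (primePowBall_antitone (by push_cast; omega) hx')
  simpa using this

/-- **Every quasi-character has a conductor exponent** (Tate 1950, §2.3: "we must have
`c̃(1 + 𝔭^ν) = 1` for sufficiently large `ν`; selecting `ν` minimal …"; Bushnell–Henniart 2006,
§1.8): `ker χ` is open, so it contains some `U^n`; the least such `n` is the conductor exponent.
[cite: Tate1950, §2.3] -/
theorem QuasiChar.exists_hasConductorExp (χ : QuasiChar F) : ∃ a : ℕ, χ.HasConductorExp a := by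
  classical
  have hker : (((χ : Fˣ →* ℂˣ).ker : Subgroup Fˣ) : Set Fˣ) ∈ 𝓝 (1 : Fˣ) :=
    (isOpen_ker_quasiChar_holds χ).mem_nhds (by simp)
  obtain ⟨n, -, hn⟩ := exists_unitFiltration_subset hker
  have hP : ∃ a : ℕ, ∀ x ∈ unitFiltration F a, χ x = 1 := ⟨n, fun x hx => by
    have h := hn hx
    rwa [SetLike.mem_coe, MonoidHom.mem_ker] at h⟩
  refine ⟨Nat.find hP, Nat.find_spec hP, fun b hb => ?_⟩
  have h := Nat.find_min hP hb
  push Not at h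
  exact h

variable (F) in
/-- **`Fˣ` is pseudo-metrisable**: `𝓝 1` has the countable basis `(U^{n+1})_n`, so the right
uniformity of the topological group `Fˣ` is countably generated. A theorem (invoke with
`haveI`). [folklore] -/
theorem pseudoMetrizableSpace_units : TopologicalSpace.PseudoMetrizableSpace Fˣ := by
  have hb : (𝓝 (1 : Fˣ)).HasBasis (fun _ : ℕ => True) (fun n => unitFiltration F (n + 1)) := by
    refine ⟨fun V => ⟨fun hV => ?_, fun ⟨n, _, hn⟩ =>
      Filter.mem_of_superset (unitFiltration_mem_nhds_one _) hn⟩⟩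
    obtain ⟨n, hn1, hn⟩ := exists_unitFiltration_subset hV
    refine ⟨n - 1, trivial, ?_⟩
    rwa [Nat.sub_add_cancel hn1]
  haveI : (𝓝 (1 : Fˣ)).IsCountablyGenerated := hb.isCountablyGenerated
  refine ⟨⟨IsTopologicalGroup.rightUniformSpace Fˣ, rfl, ?_⟩⟩
  change (Filter.comap (fun p : Fˣ × Fˣ => p.2 * p.1⁻¹) (𝓝 1)).IsCountablyGenerated
  infer_instance

variable (F) in
/-- **`Fˣ` is `σ`-compact**: it is the union of the compact shells `A_k`, `k ∈ ℤ`. A theorem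
(invoke with `haveI`). [folklore] -/
theorem sigmaCompactSpace_units : SigmaCompactSpace Fˣ := by
  refine SigmaCompactSpace_iff_exists_compact_covering.2
    ⟨fun n : ℕ => {x : Fˣ | normAbs F (x : F) = (residueFieldCard F : ℝ≥0)⁻¹ ^ (n : ℤ)} ∪
        {x : Fˣ | normAbs F (x : F) = (residueFieldCard F : ℝ≥0)⁻¹ ^ (-(n : ℤ))},
      fun n => (isCompact_shell _).union (isCompact_shell _), ?_⟩
  refine Set.eq_univ_of_forall fun x => Set.mem_iUnion.2 ?_
  obtain ⟨k, hk⟩ := exists_normAbs_eq_inv_zpow x.ne_zero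
  rcases le_or_gt 0 k with h | h
  · exact ⟨k.toNat, Or.inl (by rw [Set.mem_setOf_eq, hk, Int.toNat_of_nonneg h])⟩
  · exact ⟨(-k).toNat, Or.inr (by rw [Set.mem_setOf_eq, hk, Int.toNat_of_nonneg (by omega), neg_neg])⟩

variable (F) in
/-- **`Fˣ` is second countable** (`σ`-compact and pseudo-metrisable). A theorem (invoke with
`haveI`). [folklore] -/
theorem secondCountableTopology_units : SecondCountableTopology Fˣ := by
  haveI := pseudoMetrizableSpace_units F
  haveI := sigmaCompactSpace_units F
  infer_instance

variable [MeasurableSpace F] [BorelSpace F]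

/-- Haar measures on `Fˣ` are regular (`Fˣ` is `σ`-compact and pseudo-metrisable). A theorem
(invoke with `haveI`). [folklore] -/
theorem regular_of_isHaarMeasure_units (μ' : Measure Fˣ) [μ'.IsHaarMeasure] : μ'.Regular := by
  haveI : BorelSpace Fˣ := Units.borelSpace
  haveI : T2Space F := (GaloisRepresentations.IsNonarchimedeanLocalField.isLocalField F).toT2Space
  haveI := pseudoMetrizableSpace_units F
  haveI := sigmaCompactSpace_units F
  infer_instance

/-- **Haar measures on `Fˣ` are inversion invariant** (`Fˣ` is abelian; regular Haar measures
on abelian groups are inversion invariant). A theorem (invoke with `haveI`). [folklore] -/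
theorem isInvInvariant_of_isHaarMeasure_units (μ' : Measure Fˣ) [μ'.IsHaarMeasure] :
    μ'.IsInvInvariant := by
  haveI : BorelSpace Fˣ := Units.borelSpace
  haveI : T2Space F := (GaloisRepresentations.IsNonarchimedeanLocalField.isLocalField F).toT2Space
  haveI := regular_of_isHaarMeasure_units μ'
  infer_instance

end UnitFiltration

end Literature.NumberTheory.Automorphic
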